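import Mathlib
import HarnessLib
import Literature.MathematicalPhysics.StatisticalMechanics.RenormalisationMapP2Fluct
import Literature.MathematicalPhysics.StatisticalMechanics.RenormalisationMapBlockTerm
import Literature.MathematicalPhysics.StatisticalMechanics.RenormalisationMapBlockBracket
import Literature.MathematicalPhysics.StatisticalMechanics.RenormalisationMapRemainderRegroup
import Literature.MathematicalPhysics.StatisticalMechanics.RenormalisationMapZero
import Literature.MathematicalPhysics.StatisticalMechanics.LinearisedMap

/-!
# The summands of `S(H,K)(U) = blockPart + Σ₁ + Σ₂ᴸ + Σ₃ + Σ₄` are `C^{r₀}` (torus data)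

Regularity bookkeeping for the Lipschitz estimate of the renormalisation map ([ABKM19] Theorem 6.8 /
Lemma 9.6): the weighted-norm bounds `TayNormLE` are additive only on `C^{r₀}` functionals
(`TayNormLE.add`), so assembling `S(H,K) − S(H',K')` from its five Lipschitz-bounded pieces
(RenormalisationMapDecompositionABKM, RenormalisationMapRemainderOne/TwoLarge/Three/Four, the block part of
`C_k`) needs each piece to be `C^{r₀}`.  For the torus data (`‖H‖_{k,0} ≤ 1/8`, `‖K‖_k^{(A)} ≤ C`,
`K` factorising with `K(∅) = 1`, local, `C^{r₀}`):

* `contDiff_bprod_expNegH`, `contDiff_bprod_one_sub_expNegH` — the block products;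
* **`contDiff_reblockTop_abkm`** — `φ ↦ p_X(φ)·(R[P₂(X)](φ) + (1−e^{−H̃})^X(φ))` (summand of `Σ₂ᴸ`, `Σ₃`);
* **`contDiff_reblockSub_abkm`** — `φ ↦ p_X(φ)·((1−e^{−H̃})^{X₁}(φ)·R[P₂(X∖X₁)](φ))` (summand of `Σ₄`);
* **`contDiff_blockSummand_abkm`** — the summand of `Σ₁` on a block `B ∈ blockPartIndex`;
* **`contDiff_blockPart_abkm`** — `blockPart D K U`.

Everything is proved; no named fact.

## References
* S. Adams, S. Buchholz, R. Kotecký, S. Müller, arXiv:1910.13564, Theorem 6.8, Lemma 9.6, Lemma 8.4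
  [AdamsBuchholzKoteckyMuller2019].
-/

noncomputable section

namespace Literature.MathematicalPhysics.StatisticalMechanics.GradientRG

open scoped BigOperators Classical
open Finset MeasureTheory
open Literature.MathematicalPhysics.StatisticalMechanics.TorusPolymer
  (IsPolymer blocks polys bprod blockOf thicken reblock boxCorner mem_polys mem_blocks numBlocks isPolymer_blockOf
    card_blocks_eq_numBlocks blocks_blockOf empty_mem_polys sum_rest_blockOf_eq_zero)
open Literature.Barriers.CriticalPhenomena.LongRangePhi4.Polymer (IsConn components)
open Literature.MathematicalPhysics.QuantumFieldTheory

variable {d M : ℕ} [NeZero M]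

/-- The block product `(e^{−H₀})^Z` is smooth. [cite: AdamsBuchholzKoteckyMuller2019, Lemma 9.3] -/
theorem contDiff_bprod_expNegH (s : ℕ) (H₀ : RelevantHamiltonian ℂ d) (Z : Finset (Fin d → ZMod M)) (r₀ : ℕ) :
    ContDiff ℝ r₀ (fun φ : (Fin d → ZMod M) → ℝ => bprod s (fun B => expNegH H₀ B φ) Z) := by
  unfold TorusPolymer.bprod
  exact contDiff_prod fun B _ => (contDiff_eval H₀ B (n := r₀)).neg.cexp

/-- The block product `(1 − e^{−H₀})^Z` is smooth. [cite: AdamsBuchholzKoteckyMuller2019, Lemma 9.3] -/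
theorem contDiff_bprod_one_sub_expNegH (s : ℕ) (H₀ : RelevantHamiltonian ℂ d) (Z : Finset (Fin d → ZMod M))
    (r₀ : ℕ) :
    ContDiff ℝ r₀ (fun φ : (Fin d → ZMod M) → ℝ => bprod s (fun B => 1 - expNegH H₀ B φ) Z) := by
  unfold TorusPolymer.bprod
  exact contDiff_prod fun B _ => contDiff_const.sub (contDiff_eval H₀ B (n := r₀)).neg.cexp

/-- **The summand of `Σ₂ᴸ` / `Σ₃` is `C^{r₀}`**: `φ ↦ p_X(φ)·(R[P₂(X)](φ) + (1−e^{−H̃})^X(φ))` for a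
`k`-polymer `X` and the torus data. [cite: AdamsBuchholzKoteckyMuller2019, Lemma 9.6 / Lemma 8.4] -/
theorem contDiff_reblockTop_abkm {L N Mord R n p r₀ : ℕ} {θbar lam μ δ₁ δ₀ A𝒫 h A : ℝ}
    {𝒞 : ℕ → (Fin d → ZMod M) → ℝ} (hd : 2 ≤ d) (hLodd : Odd L)
    (hM : M = L ^ N) {k : ℕ} (hkN : k + 1 ≤ N) (hp : d / 2 + 1 ≤ p) (hMord : d / 2 + 1 ≤ Mord)
    (hθbar : 0 < θbar) (hlam : 0 < lam)
    (hB : AbkmWeightBounds L N Mord R n θbar lam μ δ₁ δ₀ A𝒫 𝒞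
      (abkmWeightData L N Mord R θbar (schedDelta δ₀ δ₁ N) 𝒞))
    (hδ₀ : 0 < δ₀) (hδ₁ : 0 < δ₁) (hh : 0 < h) (hh0 : hZeroSq d R δ₀ δ₁ ≤ h ^ 2) (hA : 0 < A)
    {X : Finset (Fin d → ZMod M)} (hX : IsPolymer (L ^ k) X) (Ht : RelevantHamiltonian ℂ d)
    {H : RelevantHamiltonian ℂ d}
    (hH : hamNorm (fieldWt h (L : ℝ) d k) ((L : ℝ) ^ k) (L ^ (d * k)) H ≤ 1 / 8)
    {K : Finset (Fin d → ZMod M) → ((Fin d → ZMod M) → ℝ) → ℂ} {C : ℝ} (hC : 0 ≤ C)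
    (hK : WeakNormLE (abkmNormParams L N Mord R p r₀ h θbar A (schedDelta δ₀ δ₁ N) 𝒞) k K C)
    (hKfac : Factorises (L ^ k) K) (hK0 : ∀ φ, K ∅ φ = 1) (hKd : ∀ Y, ContDiff ℝ r₀ (K Y))
    (hKloc : ∀ Y, IsPolymer (L ^ k) Y → IsConn Y →
      IsGaugeLocal ((abkmNormParams L N Mord R p r₀ h θbar A (schedDelta δ₀ δ₁ N) 𝒞).gauge k Y) (K Y))
    (U : Finset (Fin d → ZMod M)) :
    ContDiff ℝ r₀ (fun φ : (Fin d → ZMod M) → ℝ =>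
      bprod (L ^ k) (fun B => expNegH Ht B φ) (U \ X) * bprod (L ^ k) (fun B => expNegH (-Ht) B φ) (X \ U) *
        (fluct (𝒞 (k + 1)) (polyP2 (L ^ k) H K X) φ + bprod (L ^ k) (fun B => 1 - expNegH Ht B φ) X)) := by
  have hR := contDiff_fluct_polyP2_abkm hd hLodd hM hkN hp hMord hθbar hlam hB hδ₀ hδ₁ hh hh0 hA hX hH hC hK hKfac
    hK0 hKd hKloc
  exact ((contDiff_bprod_expNegH _ Ht _ r₀).mul (contDiff_bprod_expNegH _ (-Ht) _ r₀)).mul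
    (hR.add (contDiff_bprod_one_sub_expNegH _ Ht _ r₀))

/-- **The summand of `Σ₄` is `C^{r₀}`**: `φ ↦ p_X(φ)·((1−e^{−H̃})^{X₁}(φ)·R[P₂(X∖X₁)](φ))` for a `k`-polymer
`X`, `X₁ ∈ 𝓟_k(X)`, and the torus data. [cite: AdamsBuchholzKoteckyMuller2019, Lemma 9.6 / Lemma 8.4] -/
theorem contDiff_reblockSub_abkm {L N Mord R n p r₀ : ℕ} {θbar lam μ δ₁ δ₀ A𝒫 h A : ℝ}
    {𝒞 : ℕ → (Fin d → ZMod M) → ℝ} (hd : 2 ≤ d) (hLodd : Odd L)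
    (hM : M = L ^ N) {k : ℕ} (hkN : k + 1 ≤ N) (hp : d / 2 + 1 ≤ p) (hMord : d / 2 + 1 ≤ Mord)
    (hθbar : 0 < θbar) (hlam : 0 < lam)
    (hB : AbkmWeightBounds L N Mord R n θbar lam μ δ₁ δ₀ A𝒫 𝒞
      (abkmWeightData L N Mord R θbar (schedDelta δ₀ δ₁ N) 𝒞))
    (hδ₀ : 0 < δ₀) (hδ₁ : 0 < δ₁) (hh : 0 < h) (hh0 : hZeroSq d R δ₀ δ₁ ≤ h ^ 2) (hA : 0 < A)
    {X : Finset (Fin d → ZMod M)} (hX : IsPolymer (L ^ k) X) {X₁ : Finset (Fin d → ZMod M)}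
    (hX₁ : X₁ ∈ polys (L ^ k) X) (Ht : RelevantHamiltonian ℂ d)
    {H : RelevantHamiltonian ℂ d}
    (hH : hamNorm (fieldWt h (L : ℝ) d k) ((L : ℝ) ^ k) (L ^ (d * k)) H ≤ 1 / 8)
    {K : Finset (Fin d → ZMod M) → ((Fin d → ZMod M) → ℝ) → ℂ} {C : ℝ} (hC : 0 ≤ C)
    (hK : WeakNormLE (abkmNormParams L N Mord R p r₀ h θbar A (schedDelta δ₀ δ₁ N) 𝒞) k K C)
    (hKfac : Factorises (L ^ k) K) (hK0 : ∀ φ, K ∅ φ = 1) (hKd : ∀ Y, ContDiff ℝ r₀ (K Y))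
    (hKloc : ∀ Y, IsPolymer (L ^ k) Y → IsConn Y →
      IsGaugeLocal ((abkmNormParams L N Mord R p r₀ h θbar A (schedDelta δ₀ δ₁ N) 𝒞).gauge k Y) (K Y))
    (U : Finset (Fin d → ZMod M)) :
    ContDiff ℝ r₀ (fun φ : (Fin d → ZMod M) → ℝ =>
      bprod (L ^ k) (fun B => expNegH Ht B φ) (U \ X) * bprod (L ^ k) (fun B => expNegH (-Ht) B φ) (X \ U) *
        (bprod (L ^ k) (fun B => 1 - expNegH Ht B φ) X₁ * fluct (𝒞 (k + 1)) (polyP2 (L ^ k) H K (X \ X₁)) φ)) := by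
  have hXp : IsPolymer (L ^ k) (X \ X₁) := hX.sdiff (mem_polys.1 hX₁).2
  have hR := contDiff_fluct_polyP2_abkm hd hLodd hM hkN hp hMord hθbar hlam hB hδ₀ hδ₁ hh hh0 hA hXp hH hC hK hKfac
    hK0 hKd hKloc
  exact ((contDiff_bprod_expNegH _ Ht _ r₀).mul (contDiff_bprod_expNegH _ (-Ht) _ r₀)).mul
    ((contDiff_bprod_one_sub_expNegH _ Ht _ r₀).mul hR)

/-- **The summand of `Σ₁` is `C^{r₀}`** on a block `B = B_y` (torus data; the `rest(B)` term is the
fluctuation integral of `0`). [cite: AdamsBuchholzKoteckyMuller2019, Theorem 6.8 / Lemma 8.4] -/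
theorem contDiff_blockSummand_abkm {L N Mord R n p r₀ : ℕ} {θbar lam μ δ₁ δ₀ A𝒫 h A : ℝ}
    {𝒞 : ℕ → (Fin d → ZMod M) → ℝ} (hd : 2 ≤ d) (hθbar : 0 < θbar) (hlam : 0 < lam)
    (hB : AbkmWeightBounds L N Mord R n θbar lam μ δ₁ δ₀ A𝒫 𝒞
      (abkmWeightData L N Mord R θbar (schedDelta δ₀ δ₁ N) 𝒞))
    (hLodd : Odd L) (hM : M = L ^ N) {k : ℕ} (hkN : k + 1 ≤ N) (hδ₀ : 0 < δ₀) (hδ₁ : 0 < δ₁) (hh : 0 < h)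
    (hh0 : hZeroSq d R δ₀ δ₁ ≤ h ^ 2) (hMord : d / 2 + 1 ≤ Mord) (hp : d / 2 + 1 ≤ p) (hA : 0 < A)
    (D : StepData d M) (hD𝒞 : D.𝒞 = 𝒞 (k + 1)) (y : Fin d → ZMod M) (Ht : RelevantHamiltonian ℂ d)
    {H : RelevantHamiltonian ℂ d}
    (hH : hamNorm (fieldWt h (L : ℝ) d k) ((L : ℝ) ^ k) (L ^ (d * k)) H ≤ 1 / 8)
    {K : Finset (Fin d → ZMod M) → ((Fin d → ZMod M) → ℝ) → ℂ} {C : ℝ} (hC : 0 ≤ C)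
    (hK : WeakNormLE (abkmNormParams L N Mord R p r₀ h θbar A (schedDelta δ₀ δ₁ N) 𝒞) k K C)
    (hKd : ∀ Y, ContDiff ℝ r₀ (K Y))
    (hKloc : ∀ Y, IsPolymer (L ^ k) Y → IsConn Y →
      IsGaugeLocal ((abkmNormParams L N Mord R p r₀ h θbar A (schedDelta δ₀ δ₁ N) 𝒞).gauge k Y) (K Y))
    (U : Finset (Fin d → ZMod M)) :
    ContDiff ℝ r₀ (fun φ : (Fin d → ZMod M) → ℝ =>
      (bprod (L ^ k) (fun B' => expNegH Ht B' φ) (U \ blockOf (L ^ k) y) *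
            bprod (L ^ k) (fun B' => expNegH (-Ht) B' φ) (blockOf (L ^ k) y \ U) - 1) * blockTerm D K (blockOf (L ^ k) y) φ +
        bprod (L ^ k) (fun B' => expNegH Ht B' φ) (U \ blockOf (L ^ k) y) *
            bprod (L ^ k) (fun B' => expNegH (-Ht) B' φ) (blockOf (L ^ k) y \ U) *
          (fluctDefect (𝒞 (k + 1)) H (blockOf (L ^ k) y) φ +
            (expNegH (stepOpA (gradCov (𝒞 (k + 1))) H) (blockOf (L ^ k) y) φ - 1) *
              (1 - Complex.exp (-(eval (opB D K) (blockOf (L ^ k) y) φ))) -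
            (Complex.exp (-(eval (opB D K) (blockOf (L ^ k) y) φ)) - 1 + eval (opB D K) (blockOf (L ^ k) y) φ)) +
        bprod (L ^ k) (fun B' => expNegH Ht B' φ) (U \ blockOf (L ^ k) y) *
            bprod (L ^ k) (fun B' => expNegH (-Ht) B' φ) (blockOf (L ^ k) y \ U) *
          fluct (𝒞 (k + 1)) (fun ψ => ∑ Y ∈ ((polys (L ^ k) (blockOf (L ^ k) y)).erase (blockOf (L ^ k) y)).erase ∅,
            bprod (L ^ k) (fun B' => expNegH H B' ψ - 1) (blockOf (L ^ k) y \ Y) * K Y ψ) φ) := by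
  have hk1 : k + 1 ≤ N + 1 := by omega
  have hk : k ≤ N := by omega
  have hG := contDiff_blockTerm_abkm hθbar hlam hB hLodd hM hk1 hA D hD𝒞 y hC hK hKd hKloc
  have hΦ := contDiff_blockBracket_abkm (p := p) (r₀ := r₀) (A := A) hd hθbar hlam hB hLodd hM hk hδ₀ hδ₁ hh hh0 hMord
    hp y (opB D K) hH
  have hrest : (fun ψ : (Fin d → ZMod M) → ℝ =>
      ∑ Y ∈ ((polys (L ^ k) (blockOf (L ^ k) y)).erase (blockOf (L ^ k) y)).erase ∅,
        bprod (L ^ k) (fun B' => expNegH H B' ψ - 1) (blockOf (L ^ k) y \ Y) * K Y ψ) = fun _ => (0 : ℂ) := by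
    funext ψ; exact sum_rest_blockOf_eq_zero _ _ _
  have hR : ContDiff ℝ r₀ (fluct (𝒞 (k + 1)) (fun ψ : (Fin d → ZMod M) → ℝ =>
      ∑ Y ∈ ((polys (L ^ k) (blockOf (L ^ k) y)).erase (blockOf (L ^ k) y)).erase ∅,
        bprod (L ^ k) (fun B' => expNegH H B' ψ - 1) (blockOf (L ^ k) y \ Y) * K Y ψ)) := by
    rw [hrest, fluct_const]; exact contDiff_const
  have hpB := (contDiff_bprod_expNegH (L ^ k) Ht (U \ blockOf (L ^ k) y) r₀).mul
    (contDiff_bprod_expNegH (L ^ k) (-Ht) (blockOf (L ^ k) y \ U) r₀)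
  exact (((hpB.sub contDiff_const).mul hG).add (hpB.mul hΦ)).add (hpB.mul hR)

/-- **`blockPart D K U` is `C^{r₀}`** for the torus data (`D.s = L^k`).
[cite: AdamsBuchholzKoteckyMuller2019, Ch. 10.1 (10.3) / Lemma 8.4] -/
theorem contDiff_blockPart_abkm {L N Mord R n p r₀ : ℕ} {θbar lam μ δ₁ δ₀ A𝒫 h A : ℝ}
    {𝒞 : ℕ → (Fin d → ZMod M) → ℝ} (hθbar : 0 < θbar) (hlam : 0 < lam)
    (hB : AbkmWeightBounds L N Mord R n θbar lam μ δ₁ δ₀ A𝒫 𝒞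
      (abkmWeightData L N Mord R θbar (schedDelta δ₀ δ₁ N) 𝒞))
    (hLodd : Odd L) (hM : M = L ^ N) {k : ℕ} (hk : k + 1 ≤ N + 1) (hA : 0 < A)
    (D : StepData d M) (hDs : D.s = L ^ k) (hD𝒞 : D.𝒞 = 𝒞 (k + 1))
    {K : Finset (Fin d → ZMod M) → ((Fin d → ZMod M) → ℝ) → ℂ} {C : ℝ} (hC : 0 ≤ C)
    (hK : WeakNormLE (abkmNormParams L N Mord R p r₀ h θbar A (schedDelta δ₀ δ₁ N) 𝒞) k K C)
    (hKd : ∀ X, ContDiff ℝ r₀ (K X))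
    (hKloc : ∀ X, IsPolymer (L ^ k) X → IsConn X →
      IsGaugeLocal ((abkmNormParams L N Mord R p r₀ h θbar A (schedDelta δ₀ δ₁ N) 𝒞).gauge k X) (K X))
    (U : Finset (Fin d → ZMod M)) :
    ContDiff ℝ r₀ (blockPart D K U) := by
  have hfun : blockPart D K U = fun φ => ∑ B ∈ blockPartIndex D U, blockTerm D K B φ := by
    funext φ; rfl
  rw [hfun]
  refine ContDiff.sum fun B hB' => ?_
  have hBb := blockPartIndex_subset_blocks D U hB'
  rw [hDs] at hBb
  obtain ⟨y, -, rfl⟩ := mem_blocks.1 hBb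
  exact contDiff_blockTerm_abkm hθbar hlam hB hLodd hM hk hA D hD𝒞 y hC hK hKd hKloc

end Literature.MathematicalPhysics.StatisticalMechanics.GradientRG

end
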